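import Mathlib
import Summits.Ventures.PercRepro2.MixChordOStarMain

/-!
# THE `o`–ROOT STAR IN THE SUPPORT GRAPH (blind cell PercRepro2, night-1 g24; proofs/NIGHT1-G24.md §6)

The class of MixChordOStarMain.lean asked of the LITERAL graph (`a₃` has exactly the two edges `g = {a₃, o}`,
`e = {a₃, a₁}`); here the same with every OTHER edge at `a₃` of weight `0` (`hstar : ∀ e', a₃ ∈ ends e' →
e' ≠ g → e' ≠ e → p e' = 0`), through g23's support transport (`nMixChord_normD_restrict_iff`,
`nMixChord_normDZ2_restrict_iff`, `HCov_restrict_iff`): `starSupport ends a₃ g e` = the edges that are not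
«at `a₃` and different from `g` and `e`», on which the star is literal (`star_restrict`).
**`dChord_o_edge_of_o_root_star_support`**, **`HCov_o_root_star_support`**,
**`dz2Chord_o_edge_of_o_root_star_support`**.  Own code; standard axioms.
-/

namespace Summit.Ventures.PercRepro2

open UnionCluster CovForm

namespace Mix

namespace OStar

open Support

section SupportStar

open scoped Classical in
/-- The edges that are not «at `a₃` and different from `g` and `e`». -/
noncomputable def starSupport {V : Type*} {E : Type*} [Fintype E] (ends : E → Sym2 V) (a₃ : V) (g e : E) :
    Finset E :=
  Finset.univ.filter fun e' => ¬ (a₃ ∈ ends e' ∧ e' ≠ g ∧ e' ≠ e)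

variable {V : Type*} {E : Type*} [Fintype E] [DecidableEq E] [Fintype V] [DecidableEq V] {R : Type*}
  [Field R] [LinearOrder R] [IsStrictOrderedRing R]

variable (p : E → R) (ends : E → Sym2 V) {o a₁ a₂ a₃ : V} (b : V) {f g e : E}

omit [DecidableEq E] [Fintype V] [DecidableEq V] [Field R] [LinearOrder R] [IsStrictOrderedRing R] in
/-- Membership in `starSupport`. -/
lemma mem_starSupport {e' : E} : e' ∈ starSupport ends a₃ g e ↔ ¬ (a₃ ∈ ends e' ∧ e' ≠ g ∧ e' ≠ e) := by
  classical
  simp [starSupport]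

omit [DecidableEq E] [Fintype V] [DecidableEq V] [LinearOrder R] [IsStrictOrderedRing R] in
/-- Every edge off `starSupport` has weight `0` under the support-star hypothesis. -/
lemma starSupport_zero (hstar : ∀ e', a₃ ∈ ends e' → e' ≠ g → e' ≠ e → p e' = 0) :
    ∀ e', e' ∉ starSupport ends a₃ g e → p e' = 0 := by
  intro e' he'
  rw [mem_starSupport, not_not] at he'
  exact hstar e' he'.1 he'.2.1 he'.2.2

omit [DecidableEq E] [Fintype V] [DecidableEq V] [Field R] [LinearOrder R] [IsStrictOrderedRing R] in
/-- `g` lies in the star support. -/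
lemma g_mem_starSupport : g ∈ starSupport ends a₃ g e := by
  rw [mem_starSupport]
  exact fun h => h.2.1 rfl

omit [DecidableEq E] [Fintype V] [DecidableEq V] [Field R] [LinearOrder R] [IsStrictOrderedRing R] in
/-- `e` lies in the star support. -/
lemma e_mem_starSupport : e ∈ starSupport ends a₃ g e := by
  rw [mem_starSupport]
  exact fun h => h.2.2 rfl

omit [DecidableEq E] [Fintype V] [DecidableEq V] [Field R] [LinearOrder R] [IsStrictOrderedRing R] in
/-- The `o`-edge lies in the star support. -/
lemma o_edge_mem_starSupport (hf : ends f = s(o, a₁)) (ho : o ≠ a₃) (h31 : a₃ ≠ a₁) :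
    f ∈ starSupport ends a₃ g e := by
  rw [mem_starSupport]
  rintro ⟨h, -⟩
  rw [hf, Sym2.mem_iff] at h
  rcases h with h | h
  · exact ho h.symm
  · exact h31 h

omit [DecidableEq E] [Fintype V] [DecidableEq V] [Field R] [LinearOrder R] [IsStrictOrderedRing R] in
/-- In the restricted graph the star is literal: `g` and `e` are the only edges at `a₃`. -/
lemma star_restrict :
    ∀ e' : {e' // e' ∈ starSupport ends a₃ g e},
      a₃ ∈ restrictEnds (starSupport ends a₃ g e) ends e' →
        e' = ⟨g, g_mem_starSupport ends⟩ ∨ e' = ⟨e, e_mem_starSupport ends⟩ := by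
  intro e' he'
  have h := (mem_starSupport ends).1 e'.2
  by_cases h1 : e' = ⟨g, g_mem_starSupport ends⟩
  · exact Or.inl h1
  · refine Or.inr ?_
    by_contra h2
    exact h ⟨he', fun hg => h1 (Subtype.ext hg), fun he => h2 (Subtype.ext he)⟩

/-- **The `o`–root star in the support graph: the `D`-chord along `{o, a₁}`** (every other edge at `a₃`
of weight `0`). -/
theorem dChord_o_edge_of_o_root_star_support (hp : IsProbVec p) (hf : ends f = s(o, a₁))
    (hg : ends g = s(a₃, o)) (he : ends e = s(a₃, a₁))
    (hstar : ∀ e', a₃ ∈ ends e' → e' ≠ g → e' ≠ e → p e' = 0)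
    (h13 : a₁ ≠ a₃) (h23 : a₂ ≠ a₃) (ho1 : o ≠ a₁) (ho3 : o ≠ a₃) (hb3 : b ≠ a₃) :
    NMixChord (normD ends a₁ a₂ a₃) p ends o a₁ a₂ a₃ b f := by
  have hS := starSupport_zero p ends hstar
  have hfS := o_edge_mem_starSupport ends (g := g) (e := e) hf ho3 h13.symm
  rw [nMixChord_normD_restrict_iff _ hS ends o a₁ a₂ a₃ b hfS]
  have hg' : restrictEnds (starSupport ends a₃ g e) ends ⟨g, g_mem_starSupport ends⟩ = s(a₃, o) := hg
  have he' : restrictEnds (starSupport ends a₃ g e) ends ⟨e, e_mem_starSupport ends⟩ = s(a₃, a₁) := he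
  exact dChord_o_edge_of_o_root_star _ _ b (isProbVec_restrict p _ hp) hf hg' he' (star_restrict ends)
    h13 h23 ho1 ho3 hb3

/-- **(HCOV) on the `o`–root star in the support graph.** -/
theorem HCov_o_root_star_support (hp : IsProbVec p) (hg : ends g = s(a₃, o)) (he : ends e = s(a₃, a₁))
    (hstar : ∀ e', a₃ ∈ ends e' → e' ≠ g → e' ≠ e → p e' = 0)
    (h13 : a₁ ≠ a₃) (h23 : a₂ ≠ a₃) (ho1 : o ≠ a₁) (ho3 : o ≠ a₃) (hb3 : b ≠ a₃) :
    HCov p ends o a₁ a₂ a₃ b := by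
  have hS := starSupport_zero p ends hstar
  rw [HCov_restrict_iff _ hS ends o a₁ a₂ a₃ b]
  have hg' : restrictEnds (starSupport ends a₃ g e) ends ⟨g, g_mem_starSupport ends⟩ = s(a₃, o) := hg
  have he' : restrictEnds (starSupport ends a₃ g e) ends ⟨e, e_mem_starSupport ends⟩ = s(a₃, a₁) := he
  exact HCov_o_root_star _ _ b (isProbVec_restrict p _ hp) hg' he' (star_restrict ends) h13 h23 ho1 ho3 hb3

/-- **The chain's row on the `o`–root star in the support graph** (`NMixChord normDZ2`). -/
theorem dz2Chord_o_edge_of_o_root_star_support (hp : IsProbVec p) (hf : ends f = s(o, a₁))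
    (hg : ends g = s(a₃, o)) (he : ends e = s(a₃, a₁))
    (hstar : ∀ e', a₃ ∈ ends e' → e' ≠ g → e' ≠ e → p e' = 0)
    (h13 : a₁ ≠ a₃) (h23 : a₂ ≠ a₃) (ho1 : o ≠ a₁) (ho3 : o ≠ a₃) (hb3 : b ≠ a₃) :
    NMixChord (normDZ2 ends a₁ a₂ a₃) p ends o a₁ a₂ a₃ b f :=
  nMixChord_DZ2_of_D hp (dChord_o_edge_of_o_root_star_support p ends b hp hf hg he hstar h13 h23 ho1 ho3 hb3)
    (HCov_o_root_star_support (Function.update p f 0) ends b (hp.update f le_rfl zero_le_one) hg he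
      (fun e' h3 hg' he' => by
        rw [Function.update_of_ne]
        · exact hstar e' h3 hg' he'
        · intro hef
          rw [hef, hf, Sym2.mem_iff] at h3
          rcases h3 with h | h
          · exact ho3 h.symm
          · exact h13 h.symm)
      h13 h23 ho1 ho3 hb3)

end SupportStar

end OStar

end Mix

end Summit.Ventures.PercRepro2
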